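import Summits.AtomisticToContinuum.HydrodynamicLimit.Theses.ImplosionDichotomy
import Summits.AtomisticToContinuum.HydrodynamicLimit.Theorems.PolynomialCompression.Negative.PdeForm
import Summits.AtomisticToContinuum.HydrodynamicLimit.Theorems.DenseExcursion.Negative.Dichotomy

/-!
# `DiluteSelfConsistency` is a particle-free PDE statement, and the ideal-fate cut of line `birth` is exact

Support lemmas for the crux `ImplosionDichotomy.DiluteSelfConsistency` (stmt-AtomisticToContinuum-3091), landed by the
line lead of the registered skeleton `Cruxes/DiluteSelfConsistency/Lines/birth.lean` (stubs `stub_boundedIdealDilute`,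
`stub_unboundedIdealDilute`) so that both stubs, the standing disprover and every later seat can import them:

* `diluteSelfConsistency_iff_pde` — THE CRUX WITHOUT PARTICLES. By the landed data pinning
  (`PolynomialCompressionPDE.admissible_iff_data`: below the statics threshold `σ₁(a₀, θ₀, u₀) ≤ 1/2` a triple of fields
  with continuous time-`0` slices is tied at `t = 0` to the local Gibbs laws through every flow family iff
  `ρ 0 = rhoLim (profileOf a₀) σ ∧ u 0 = u₀ ∧ θ 0 = θ₀`), the crux is equivalent to: for every level `η > 0` and all
  continuous positive profiles there is `σ₀ > 0` below which EVERY classical solution of the one-parameter hard-sphere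
  Euler system `p = ρθ Z(ρσ³)` with the PINNED data `(rhoLim (profileOf a₀) σ, u₀, θ₀)` keeps packing `ρσ³ < η` on its
  interval of existence. No flows, no measures, no law of large numbers remain (flow families exist below `1/2` by
  Alexander's theorem, `flows_nonempty`; the tie through one family is the tie through all,
  `DenseExcursionDichotomy.tendstoHydroFieldsAt_zero_transfer`; `T > 0` because `t ∈ Ico 0 T`, so time-`0` slices of a
  classical solution are continuous, `continuous_slices_zero`).
* `diluteSelfConsistency_of_idealFate` / `idealFate_of_diluteSelfConsistency` — the composition of line `birth` and
  its converse: splitting the particle-free statement by whether the IDEAL-GAS (`σ = 0`) classical developments of the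
  reference data `(a₀/∫a₀, u₀, θ₀)` have bounded density (Case I, `stub_boundedIdealDilute`) or not (Case II,
  `stub_unboundedIdealDilute`) is an EXACT cut — the crux is equivalent to the conjunction of the two registered stub
  statements (verbatim signatures). In particular a refutation of either stub refutes the crux (and proves the
  sibling crux `DenseExcursion`, stmt-12586, by the landed `denseExcursion_iff_not_diluteSelfConsistency`), and a proof
  of `DenseExcursion` refutes the conjunction.

prover-line-stmt-AtomisticToContinuum-3091-c1-0 (line `birth`).
-/

noncomputable section

namespace Summit.AtomisticToContinuum.HydrodynamicLimit.Theorems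

open MeasureTheory Filter Set Topology
open Literature.MathematicalPhysics.KineticTheory Literature.Analysis.FluidPDE
open Literature.Analysis.FunctionSpaces
open Summit.AtomisticToContinuum.HydrodynamicLimit.Theses.ImplosionDichotomy (DiluteSelfConsistency)
open PolynomialCompressionPDE DenseExcursionDichotomy

/-- **`DiluteSelfConsistency`, de-probabilised.** The crux is equivalent to the particle-free statement: for every
`η > 0` and all continuous positive profiles `(a₀, θ₀, u₀)` there is `σ₀ > 0` such that for `0 < σ < σ₀` every classical
hard-sphere-Euler solution on `[0, T)` with the PINNED data `ρ 0 = rhoLim (profileOf a₀) σ`, `u 0 = u₀`, `θ 0 = θ₀`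
satisfies `ρ_t(x)σ³ < η` for all `t ∈ [0, T)` and `x`. Both directions shrink the threshold below the statics threshold
`σ₁(a₀, θ₀, u₀) ≤ 1/2` of `admissible_iff_data`; `→` instantiates the crux's `∀ Φ` with a flow family from Alexander's
theorem (`flows_nonempty`), `←` moves the tie from the given family to every family
(`tendstoHydroFieldsAt_zero_transfer`) and pins the data. [folklore] -/
theorem diluteSelfConsistency_iff_pde :
    DiluteSelfConsistency ↔
      ∀ η : ℝ, 0 < η → ∀ (a₀ θ₀ : T3 → ℝ) (u₀ : T3 → V3) (ha : Continuous a₀) (ha0 : ∀ x, 0 < a₀ x),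
        Continuous θ₀ → Continuous u₀ → (∀ x, 0 < θ₀ x) →
        ∃ σ₀ : ℝ, 0 < σ₀ ∧ ∀ σ : ℝ, 0 < σ → σ < σ₀ →
          ∀ (T : ℝ) (ρ θ : ℝ → T3 → ℝ) (u : ℝ → T3 → V3), IsHardSphereEulerSolution σ T ρ u θ →
            ρ 0 = rhoLim (profileOf a₀ ha ha0) σ → u 0 = u₀ → θ 0 = θ₀ →
              ∀ t ∈ Ico 0 T, ∀ x, ρ t x * σ ^ 3 < η := by
  constructor
  · intro hD η hη a₀ θ₀ u₀ ha ha0 hθ hu hθ0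
    obtain ⟨σ₂, hσ₂, H⟩ := hD η hη a₀ θ₀ u₀ ha hθ hu ha0 hθ0
    obtain ⟨σ₁, hσ₁, hσ₁2, G⟩ := admissible_iff_data ha hθ hu ha0 hθ0
    refine ⟨min σ₁ σ₂, lt_min hσ₁ hσ₂, ?_⟩
    intro σ hσ hσlt T ρ θ u hE h1 h2 h3 t ht x
    have hσ₁' : σ < σ₁ := lt_of_lt_of_le hσlt (min_le_left _ _)
    have hσ₂' : σ < σ₂ := lt_of_lt_of_le hσlt (min_le_right _ _)
    -- `T > 0` because `t ∈ Ico 0 T`; so the time-`0` slices of the classical solution are continuous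
    obtain ⟨hρc, huc, hθc⟩ := continuous_slices_zero hE (ht.1.trans_lt ht.2)
    -- pinned data are admissible (tied through every flow family)
    obtain ⟨-, G'⟩ := G σ hσ hσ₁'
    have hall := (G' ρ θ u hρc huc hθc).2 ⟨h1, h2, h3⟩
    -- a flow family exists (Alexander, `σ < σ₁ ≤ 1/2`) to instantiate the crux's `∀ Φ`
    obtain ⟨Φ⟩ := PolynomialCompressionPDE.flows_nonempty hσ (hσ₁'.trans_le hσ₁2)
    exact H σ hσ hσ₂' T ρ θ u hE Φ (hall Φ) t ht x
  · intro hP η hη a₀ θ₀ u₀ ha hθ hu ha0 hθ0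
    obtain ⟨σ₂, hσ₂, H⟩ := hP η hη a₀ θ₀ u₀ ha ha0 hθ hu hθ0
    obtain ⟨σ₁, hσ₁, -, G⟩ := admissible_iff_data ha hθ hu ha0 hθ0
    refine ⟨min σ₁ σ₂, lt_min hσ₁ hσ₂, ?_⟩
    intro σ hσ hσlt T ρ θ u hE Φ htie t ht x
    have hσ₁' : σ < σ₁ := lt_of_lt_of_le hσlt (min_le_left _ _)
    have hσ₂' : σ < σ₂ := lt_of_lt_of_le hσlt (min_le_right _ _)
    obtain ⟨hρc, huc, hθc⟩ := continuous_slices_zero hE (ht.1.trans_lt ht.2)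
    -- the tie through `Φ` is the tie through every flow family
    have hall : ∀ Ψ : Flows σ, TendstoHydroFieldsAt (fun N => localGibbsLaw σ a₀ u₀ θ₀ N (Ψ N)) Ψ ρ u θ 0 :=
      fun Ψ => tendstoHydroFieldsAt_zero_transfer Φ Ψ htie
    obtain ⟨-, G'⟩ := G σ hσ hσ₁'
    obtain ⟨h1, h2, h3⟩ := (G' ρ θ u hρc huc hθc).1 hall
    exact H σ hσ hσ₂' T ρ θ u hE h1 h2 h3 t ht x

/-- **Composition of line `birth` (Case I → Case II → crux).** If the particle-free statement holds both for the
profiles whose ideal-gas (`σ = 0`) classical developments of the reference data `(a₀/∫a₀, u₀, θ₀)` have density bounded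
by one constant (the registered stub `stub_boundedIdealDilute`, verbatim) and for the complementary profiles (the
registered stub `stub_unboundedIdealDilute`, verbatim), then `DiluteSelfConsistency`: case split on the classifier,
then `diluteSelfConsistency_iff_pde`. [folklore] -/
theorem diluteSelfConsistency_of_idealFate
    (hI : ∀ η : ℝ, 0 < η → ∀ (a₀ θ₀ : T3 → ℝ) (u₀ : T3 → V3) (ha : Continuous a₀) (ha0 : ∀ x, 0 < a₀ x),
      Continuous θ₀ → Continuous u₀ → (∀ x, 0 < θ₀ x) →
      (∃ M : ℝ, ∀ (T₁ : ℝ) (ρ₁ θ₁ : ℝ → T3 → ℝ) (u₁ : ℝ → T3 → V3), IsHardSphereEulerSolution 0 T₁ ρ₁ u₁ θ₁ →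
          (∀ x, ρ₁ 0 x = a₀ x / ∫ y, a₀ y) → u₁ 0 = u₀ → θ₁ 0 = θ₀ → ∀ t ∈ Ico 0 T₁, ∀ x, ρ₁ t x ≤ M) →
      ∃ σ₀ : ℝ, 0 < σ₀ ∧ ∀ σ : ℝ, 0 < σ → σ < σ₀ →
        ∀ (T : ℝ) (ρ θ : ℝ → T3 → ℝ) (u : ℝ → T3 → V3), IsHardSphereEulerSolution σ T ρ u θ →
          ρ 0 = rhoLim (profileOf a₀ ha ha0) σ → u 0 = u₀ → θ 0 = θ₀ →
            ∀ t ∈ Ico 0 T, ∀ x, ρ t x * σ ^ 3 < η)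
    (hII : ∀ η : ℝ, 0 < η → ∀ (a₀ θ₀ : T3 → ℝ) (u₀ : T3 → V3) (ha : Continuous a₀) (ha0 : ∀ x, 0 < a₀ x),
      Continuous θ₀ → Continuous u₀ → (∀ x, 0 < θ₀ x) →
      (¬ ∃ M : ℝ, ∀ (T₁ : ℝ) (ρ₁ θ₁ : ℝ → T3 → ℝ) (u₁ : ℝ → T3 → V3), IsHardSphereEulerSolution 0 T₁ ρ₁ u₁ θ₁ →
          (∀ x, ρ₁ 0 x = a₀ x / ∫ y, a₀ y) → u₁ 0 = u₀ → θ₁ 0 = θ₀ → ∀ t ∈ Ico 0 T₁, ∀ x, ρ₁ t x ≤ M) →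
      ∃ σ₀ : ℝ, 0 < σ₀ ∧ ∀ σ : ℝ, 0 < σ → σ < σ₀ →
        ∀ (T : ℝ) (ρ θ : ℝ → T3 → ℝ) (u : ℝ → T3 → V3), IsHardSphereEulerSolution σ T ρ u θ →
          ρ 0 = rhoLim (profileOf a₀ ha ha0) σ → u 0 = u₀ → θ 0 = θ₀ →
            ∀ t ∈ Ico 0 T, ∀ x, ρ t x * σ ^ 3 < η) :
    DiluteSelfConsistency := by
  refine diluteSelfConsistency_iff_pde.2 fun η hη a₀ θ₀ u₀ ha ha0 hθ hu hθ0 => ?_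
  by_cases hb : ∃ M : ℝ, ∀ (T₁ : ℝ) (ρ₁ θ₁ : ℝ → T3 → ℝ) (u₁ : ℝ → T3 → V3),
      IsHardSphereEulerSolution 0 T₁ ρ₁ u₁ θ₁ → (∀ x, ρ₁ 0 x = a₀ x / ∫ y, a₀ y) → u₁ 0 = u₀ → θ₁ 0 = θ₀ →
        ∀ t ∈ Ico 0 T₁, ∀ x, ρ₁ t x ≤ M
  · exact hI η hη a₀ θ₀ u₀ ha ha0 hθ hu hθ0 hb
  · exact hII η hη a₀ θ₀ u₀ ha ha0 hθ hu hθ0 hb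

/-- **The cut of line `birth` is exact (converse of the composition).** `DiluteSelfConsistency` implies both registered
stub statements — each is the particle-free form of the crux restricted to a class of profiles — so the crux is
EQUIVALENT to `stub_boundedIdealDilute ∧ stub_unboundedIdealDilute`; a refutation of either stub at one profile is a
refutation of the crux, i.e. (by `denseExcursion_iff_not_diluteSelfConsistency`) a proof of `DenseExcursion`. [folklore] -/
theorem idealFate_of_diluteSelfConsistency (hD : DiluteSelfConsistency) :
    (∀ η : ℝ, 0 < η → ∀ (a₀ θ₀ : T3 → ℝ) (u₀ : T3 → V3) (ha : Continuous a₀) (ha0 : ∀ x, 0 < a₀ x),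
      Continuous θ₀ → Continuous u₀ → (∀ x, 0 < θ₀ x) →
      (∃ M : ℝ, ∀ (T₁ : ℝ) (ρ₁ θ₁ : ℝ → T3 → ℝ) (u₁ : ℝ → T3 → V3), IsHardSphereEulerSolution 0 T₁ ρ₁ u₁ θ₁ →
          (∀ x, ρ₁ 0 x = a₀ x / ∫ y, a₀ y) → u₁ 0 = u₀ → θ₁ 0 = θ₀ → ∀ t ∈ Ico 0 T₁, ∀ x, ρ₁ t x ≤ M) →
      ∃ σ₀ : ℝ, 0 < σ₀ ∧ ∀ σ : ℝ, 0 < σ → σ < σ₀ →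
        ∀ (T : ℝ) (ρ θ : ℝ → T3 → ℝ) (u : ℝ → T3 → V3), IsHardSphereEulerSolution σ T ρ u θ →
          ρ 0 = rhoLim (profileOf a₀ ha ha0) σ → u 0 = u₀ → θ 0 = θ₀ →
            ∀ t ∈ Ico 0 T, ∀ x, ρ t x * σ ^ 3 < η) ∧
    (∀ η : ℝ, 0 < η → ∀ (a₀ θ₀ : T3 → ℝ) (u₀ : T3 → V3) (ha : Continuous a₀) (ha0 : ∀ x, 0 < a₀ x),
      Continuous θ₀ → Continuous u₀ → (∀ x, 0 < θ₀ x) →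
      (¬ ∃ M : ℝ, ∀ (T₁ : ℝ) (ρ₁ θ₁ : ℝ → T3 → ℝ) (u₁ : ℝ → T3 → V3), IsHardSphereEulerSolution 0 T₁ ρ₁ u₁ θ₁ →
          (∀ x, ρ₁ 0 x = a₀ x / ∫ y, a₀ y) → u₁ 0 = u₀ → θ₁ 0 = θ₀ → ∀ t ∈ Ico 0 T₁, ∀ x, ρ₁ t x ≤ M) →
      ∃ σ₀ : ℝ, 0 < σ₀ ∧ ∀ σ : ℝ, 0 < σ → σ < σ₀ →
        ∀ (T : ℝ) (ρ θ : ℝ → T3 → ℝ) (u : ℝ → T3 → V3), IsHardSphereEulerSolution σ T ρ u θ →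
          ρ 0 = rhoLim (profileOf a₀ ha ha0) σ → u 0 = u₀ → θ 0 = θ₀ →
            ∀ t ∈ Ico 0 T, ∀ x, ρ t x * σ ^ 3 < η) :=
  have hP := diluteSelfConsistency_iff_pde.1 hD
  ⟨fun η hη a₀ θ₀ u₀ ha ha0 hθ hu hθ0 _ => hP η hη a₀ θ₀ u₀ ha ha0 hθ hu hθ0,
    fun η hη a₀ θ₀ u₀ ha ha0 hθ hu hθ0 _ => hP η hη a₀ θ₀ u₀ ha ha0 hθ hu hθ0⟩

/-- **Either registered stub of line `birth` refuted ⇒ `DenseExcursion`.** Packaging of the exact cut with the landed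
dichotomy: if the conjunction of the two stub statements fails, the sibling crux `DenseExcursion` (stmt-12586) holds.
[folklore] -/
theorem denseExcursion_of_not_idealFate
    (h : ¬ ((∀ η : ℝ, 0 < η → ∀ (a₀ θ₀ : T3 → ℝ) (u₀ : T3 → V3) (ha : Continuous a₀) (ha0 : ∀ x, 0 < a₀ x),
      Continuous θ₀ → Continuous u₀ → (∀ x, 0 < θ₀ x) →
      (∃ M : ℝ, ∀ (T₁ : ℝ) (ρ₁ θ₁ : ℝ → T3 → ℝ) (u₁ : ℝ → T3 → V3), IsHardSphereEulerSolution 0 T₁ ρ₁ u₁ θ₁ →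
          (∀ x, ρ₁ 0 x = a₀ x / ∫ y, a₀ y) → u₁ 0 = u₀ → θ₁ 0 = θ₀ → ∀ t ∈ Ico 0 T₁, ∀ x, ρ₁ t x ≤ M) →
      ∃ σ₀ : ℝ, 0 < σ₀ ∧ ∀ σ : ℝ, 0 < σ → σ < σ₀ →
        ∀ (T : ℝ) (ρ θ : ℝ → T3 → ℝ) (u : ℝ → T3 → V3), IsHardSphereEulerSolution σ T ρ u θ →
          ρ 0 = rhoLim (profileOf a₀ ha ha0) σ → u 0 = u₀ → θ 0 = θ₀ →
            ∀ t ∈ Ico 0 T, ∀ x, ρ t x * σ ^ 3 < η) ∧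
    (∀ η : ℝ, 0 < η → ∀ (a₀ θ₀ : T3 → ℝ) (u₀ : T3 → V3) (ha : Continuous a₀) (ha0 : ∀ x, 0 < a₀ x),
      Continuous θ₀ → Continuous u₀ → (∀ x, 0 < θ₀ x) →
      (¬ ∃ M : ℝ, ∀ (T₁ : ℝ) (ρ₁ θ₁ : ℝ → T3 → ℝ) (u₁ : ℝ → T3 → V3), IsHardSphereEulerSolution 0 T₁ ρ₁ u₁ θ₁ →
          (∀ x, ρ₁ 0 x = a₀ x / ∫ y, a₀ y) → u₁ 0 = u₀ → θ₁ 0 = θ₀ → ∀ t ∈ Ico 0 T₁, ∀ x, ρ₁ t x ≤ M) →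
      ∃ σ₀ : ℝ, 0 < σ₀ ∧ ∀ σ : ℝ, 0 < σ → σ < σ₀ →
        ∀ (T : ℝ) (ρ θ : ℝ → T3 → ℝ) (u : ℝ → T3 → V3), IsHardSphereEulerSolution σ T ρ u θ →
          ρ 0 = rhoLim (profileOf a₀ ha ha0) σ → u 0 = u₀ → θ 0 = θ₀ →
            ∀ t ∈ Ico 0 T, ∀ x, ρ t x * σ ^ 3 < η))) :
    Summit.AtomisticToContinuum.HydrodynamicLimit.Theses.ImplosionDichotomy.DenseExcursion :=
  denseExcursion_iff_not_diluteSelfConsistency.2 fun hD => h (idealFate_of_diluteSelfConsistency hD)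

end Summit.AtomisticToContinuum.HydrodynamicLimit.Theorems

end
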